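import Summits.QuantumAdvantage.QuantumAdvantage.Theorems.CubicForrelationNearExactIsExactTwelveLevelFiveCongruences
import Summits.QuantumAdvantage.QuantumAdvantage.Theorems.CubicForrelationNearExactIsExactFourFlatLemma
import Summits.QuantumAdvantage.QuantumAdvantage.Theorems.CubicForrelationNearExactIsExactTwelveTypeO1024DeadAt2932
import Summits.QuantumAdvantage.QuantumAdvantage.Theorems.CubicForrelationNearExactIsExactEightTypeEEnd

/-!
# Crux `CubicForrelation.NearExactIsExact` (stmt-QuantumAdvantage-14043) — n = 12, level-5 sides: 4-DIVISIBILITY of the twisted sign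
  patterns on the odd hyperplane, `ŝ ∈ 1024ℤ`, and the DUALITY `ê = −64·e_f`

Certificate seat `b2b-cforr-cert` (gen 23).  HONEST FRAMING: kernel-checked finite-slice lemmas (standard axioms, no `decide`) about cubic Boolean
pairs on 12 bits — the tools used to exclude the level-5 configurations R2(a), R2(b) (file `…TwelveLevelFiveR2abDeadAt2932`) and R1.
NO new value of `θ₁₂`; NOT summit progress.  Paper proof: HOME/b2b-cforr-cert-g23/PROOF-N12-928-L5.md §3–§5.

CONTENT (a side `g` with `W_g = 32u'`, odd set `P = x_P ⊕ V`, even set `P' = x' ⊕ V`, residual `e = u' − 2(−1)^f` with `e² = 1` on `P`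
and `8 ∣ e` on `P'`).
1. (`l5k_H4`) Straddling 5-flats: for `x ∈ P` and periods `a, b, c, d ∈ V`, the 5-flat with the extra direction `w = x_P ⊕ x'` (which
   swaps `P` and `P'`) has `Σ e ≡ 0 (mod 8)` (`l5c_flat5`), its `P'`-half contributes `≡ 0 (mod 8)`, and `e = ±1` on `P`: so
   `#{ε : e(x ⊕ ε·(a,b,c,d)) = −1} ≡ 0 (mod 4)` — the set `σ_P = {x ∈ P : e = −1}` has 4-divisible parametrised 4-flat counts in `P`.
2. (`l5k_H4_twist`) The same for the TWISTED pair `(f ⊕ ⟨·,y⟩, g(· ⊕ y))` (residual `(−1)^{⟨·,y⟩} e`, same `P`, `V`, still cubic, still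
   `W ∈ 32ℤ` by `ad_W_translate`): the sets `τ_y = {x ∈ P : (−1)^{x·y} e(x) = −1}` are 4-divisible on parametrised 4-flats of `P` too.
3. (`l5k_tau_card`) Restricting to the 11-flat `P` (`ffl_restrict_flats`) and the FOUR-FLAT LEMMA `ffl_four_weight`: `512 ∣ #τ_y`, i.e.
   `ŝ(y) = Σ_{x∈P} e(x)(−1)^{x·y} = 2048 − 2#τ_y ∈ 1024ℤ` (`l5k_shat`).
4. (`l5k_duality`) `ê(y) = Σ_a e(a)(−1)^{a·y} = −64·e_f(y)` with `e_f = u'_f − 2(−1)^g ∈ ℤ` whenever the partner has `W_f = 32u'_f`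
   (Walsh inversion).

References: J. Ax (1964) / R. J. McEliece (1972); MacWilliams–Sloane (1977) Ch. 13–15; R. O'Donnell (2014) §3.3.  Axioms: the standard three.
-/
set_option linter.dupNamespace false -- D-0017: single-problem summit ⇒ `QuantumAdvantage.QuantumAdvantage` by design

noncomputable section

namespace Summit.QuantumAdvantage.QuantumAdvantage.Theorems.CubicForrelation.NearExactIsExact

open Finset
open Literature.Computability.QuantumComplexity
open Literature.Computability.QuantumComplexity.BuzetChailloux (bxor zeroVec bxor_bxor_cancel_left bxor_zeroVec zeroVec_bxor bxor_comm
  bxor_self twist_zeroVec_right twist_bxor_right)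
open Literature.Computability.QuantumComplexity.DerivativeWalsh (W twist_bxor_left)
open Literature.Computability.QuantumComplexity.Simon (twist_eq_one_or)
open Summit.QuantumAdvantage.QuantumAdvantage.Theorems.SignedCubicForrelationNotPrBPP (knf_isDegLeFun_ip knf_isDegLeFun_comp)
open Summit.QuantumAdvantage.QuantumAdvantage.Theorems.NearExactIsExact.Negative (AffineDigitCaseAFourteen.ad_W_translate
  AffineDigitCaseAFourteen.ad_translate_isDegLeFun)

/-! ### Small tools -/

/-- Membership in the period group of the odd set: `a ∈ V` iff `a` preserves the odd set. [folklore] -/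
theorem l5k_memV (u' : (Fin (6 + 6) → Bool) → ℤ) (V : Finset (Fin (6 + 6) → Bool)) (xP x' : Fin (6 + 6) → Bool) (h0 : zeroVec ∈ V)
    (hadd : ∀ a ∈ V, ∀ b ∈ V, bxor a b ∈ V)
    (hS : (univ.filter fun x : Fin (6 + 6) → Bool => Odd (u' x)) = V.image (bxor xP))
    (hS' : (univ.filter fun x : Fin (6 + 6) → Bool => ¬ Odd (u' x)) = V.image (bxor x')) (a : Fin (6 + 6) → Bool) :
    a ∈ V ↔ ∀ x, (Odd (u' (bxor x a)) ↔ Odd (u' x)) := by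
  classical
  have hmemP : ∀ x, x ∈ V.image (bxor xP) ↔ Odd (u' x) := fun x => by rw [← hS]; simp
  have hmemP' : ∀ x, x ∈ V.image (bxor x') ↔ ¬ Odd (u' x) := fun x => by rw [← hS']; simp
  constructor
  · intro ha x
    constructor
    · intro h
      by_contra hx
      exact (hmemP' _).1 (fl1_coset_vadd hadd rfl ((hmemP' x).2 hx) ha) h
    · intro h
      exact (hmemP _).1 (fl1_coset_vadd hadd rfl ((hmemP x).2 h) ha)
  · intro h
    have hx' : x' ∈ V.image (bxor x') := mem_image.2 ⟨zeroVec, h0, bxor_zeroVec _⟩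
    have h1 : bxor x' a ∈ V.image (bxor x') := (hmemP' _).2 (fun hh => (hmemP' x').1 hx' ((h x').1 hh))
    obtain ⟨v, hv, hv'⟩ := mem_image.1 h1
    have : a = v := by
      have := congrArg (bxor x') hv'
      rw [bxor_bxor_cancel_left, bxor_bxor_cancel_left] at this
      exact this.symm
    rw [this]; exact hv

/-! ### 1. Four-divisibility of the sign pattern on `P` (straddling 5-flats) -/

/-- **H4 for the sign pattern on `P`.**  Cubic `f, g` on 12 bits with `W_g = 32u'`; the odd set of `u'` is the coset `x_P ⊕ V` and the even
set the coset `x' ⊕ V` (`V ∋ 0` xor-closed); `e = u' − 2(−1)^f` has `e² = 1` on the odd set and `8 ∣ e` on the even set.  Then for every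
odd point `x` and periods `a₀, …, a₃ ∈ V`: `4 ∣ #{ε : e(x ⊕ ε·a) = −1}`.  (No hypothesis on `Φ`.) [this work] -/
theorem l5k_H4 (f g : (Fin (6 + 6) → Bool) → Bool) (hf : IsDegLeFun 3 f) (hg : IsDegLeFun 3 g)
    (u' : (Fin (6 + 6) → Bool) → ℤ) (hu' : ∀ x, W (fun y => signOf (g y)) x = (2 : ℝ) ^ 5 * (u' x : ℝ))
    (V : Finset (Fin (6 + 6) → Bool)) (xP x' : Fin (6 + 6) → Bool) (h0 : zeroVec ∈ V) (hadd : ∀ a ∈ V, ∀ b ∈ V, bxor a b ∈ V)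
    (hS : (univ.filter fun x : Fin (6 + 6) → Bool => Odd (u' x)) = V.image (bxor xP))
    (hS' : (univ.filter fun x : Fin (6 + 6) → Bool => ¬ Odd (u' x)) = V.image (bxor x'))
    (hP1 : ∀ x, Odd (u' x) → (u' x - 2 * sZ (f x)) ^ 2 = 1) (hoff8 : ∀ x, ¬ Odd (u' x) → (8 : ℤ) ∣ u' x - 2 * sZ (f x))
    (x : Fin (6 + 6) → Bool) (hx : Odd (u' x)) (a : Fin 4 → Fin (6 + 6) → Bool) (ha : ∀ i, a i ∈ V) :
    4 ∣ #(univ.filter fun ε : Fin 4 → Bool =>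
      u' (fun j => x j ^^ decide (Odd #(univ.filter fun i => ε i && a i j))) -
        2 * sZ (f (fun j => x j ^^ decide (Odd #(univ.filter fun i => ε i && a i j)))) = -1) := by
  classical
  set e : (Fin (6 + 6) → Bool) → ℤ := fun x => u' x - 2 * sZ (f x) with hedef
  have hmemP : ∀ x, x ∈ V.image (bxor xP) ↔ Odd (u' x) := fun x => by rw [← hS]; simp
  have hmemP' : ∀ x, x ∈ V.image (bxor x') ↔ ¬ Odd (u' x) := fun x => by rw [← hS']; simp
  have hPV : ∀ x, x ∈ V.image (bxor xP) → ∀ a ∈ V, bxor x a ∈ V.image (bxor xP) :=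
    fun x hx a ha => fl1_coset_vadd hadd rfl hx ha
  have hPV' : ∀ x, x ∈ V.image (bxor x') → ∀ a ∈ V, bxor x a ∈ V.image (bxor x') :=
    fun x hx a ha => fl1_coset_vadd hadd rfl hx ha
  -- the swapping direction `w = x_P ⊕ x'`
  set w := bxor xP x' with hwdef
  have hxw : bxor x w ∈ V.image (bxor x') := by
    obtain ⟨v, hv, rfl⟩ := mem_image.1 ((hmemP x).2 hx)
    have : bxor (bxor xP v) w = bxor x' v := by
      funext j; simp only [bxor, w]; cases xP j <;> cases v j <;> cases x' j <;> rfl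
    rw [this]; exact mem_image.2 ⟨v, hv, rfl⟩
  -- the 5-flat sum splits into the `P`-half and the `P'`-half
  have h5 := l5c_flat5 f g hf hg u' hu' x (Fin.cons w a)
  change (8 : ℤ) ∣ ∑ ε : Fin (4 + 1) → Bool, e (fun j => x j ^^ decide (Odd #(univ.filter fun i : Fin (4 + 1) =>
      ε i && (Fin.cons w a : Fin (4 + 1) → Fin (6 + 6) → Bool) i j))) at h5
  rw [l5c_sum_split e x w a] at h5
  have hhalf' : (8 : ℤ) ∣ ∑ ε : Fin 4 → Bool, e (fun j => bxor x w j ^^ decide (Odd #(univ.filter fun i => ε i && a i j))) := by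
    refine dvd_sum fun ε _ => hoff8 _ ((hmemP' _).1 ?_)
    exact ws_flatPt_mem V h0 (fun z => z ∈ V.image (bxor x')) hPV' 4 (bxor x w) hxw a ha ε
  have hhalf : (8 : ℤ) ∣ ∑ ε : Fin 4 → Bool, e (fun j => x j ^^ decide (Odd #(univ.filter fun i => ε i && a i j))) :=
    (dvd_add_left hhalf').1 h5
  -- on `P`, `e = ±1`
  have hpm : ∀ ε : Fin 4 → Bool, e (fun j => x j ^^ decide (Odd #(univ.filter fun i => ε i && a i j))) = 1 ∨
      e (fun j => x j ^^ decide (Odd #(univ.filter fun i => ε i && a i j))) = -1 := by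
    intro ε
    have hmem := ws_flatPt_mem V h0 (fun z => z ∈ V.image (bxor xP)) hPV 4 x ((hmemP x).2 hx) a ha ε
    have h1 := hP1 _ ((hmemP _).1 hmem)
    have : (e (fun j => x j ^^ decide (Odd #(univ.filter fun i => ε i && a i j))) - 1) *
        (e (fun j => x j ^^ decide (Odd #(univ.filter fun i => ε i && a i j))) + 1) = 0 := by
      have h1' : e (fun j => x j ^^ decide (Odd #(univ.filter fun i => ε i && a i j))) ^ 2 = 1 := h1
      nlinarith
    rcases mul_eq_zero.1 this with h | h
    · left; linarith
    · right; linarith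
  have hsum : ∑ ε : Fin 4 → Bool, e (fun j => x j ^^ decide (Odd #(univ.filter fun i => ε i && a i j))) =
      16 - 2 * #(univ.filter fun ε : Fin 4 → Bool => e (fun j => x j ^^ decide (Odd #(univ.filter fun i => ε i && a i j))) = -1) := by
    have e1 : ∀ ε : Fin 4 → Bool, e (fun j => x j ^^ decide (Odd #(univ.filter fun i => ε i && a i j))) =
        1 - 2 * (if e (fun j => x j ^^ decide (Odd #(univ.filter fun i => ε i && a i j))) = -1 then 1 else 0) := by
      intro ε; rcases hpm ε with h | h <;> rw [h] <;> norm_num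
    rw [sum_congr rfl fun ε _ => e1 ε, sum_sub_distrib, sum_const, card_univ, Fintype.card_fun, Fintype.card_bool,
      Fintype.card_fin, ← mul_sum, sum_boole]
    norm_num
  rw [hsum] at hhalf
  have hN : #(univ.filter fun ε : Fin 4 → Bool => e (fun j => x j ^^ decide (Odd #(univ.filter fun i => ε i && a i j))) = -1) ≤ 16 := by
    calc _ ≤ #(univ : Finset (Fin 4 → Bool)) := card_filter_le _ _
      _ = 16 := by rw [card_univ, Fintype.card_fun, Fintype.card_bool, Fintype.card_fin]; norm_num
  have key : 4 ∣ #(univ.filter fun ε : Fin 4 → Bool =>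
      e (fun j => x j ^^ decide (Odd #(univ.filter fun i => ε i && a i j))) = -1) := by omega
  exact key

/-! ### 2. The twisted pair `(f ⊕ ⟨·,y⟩, g(· ⊕ y))` and the sets `τ_y` -/

/-- **H4 for the twisted sign patterns.**  In the setting of `l5k_H4`, for every `y`: the set `τ_y = {x ∈ P : (−1)^{x·y} e(x) = −1}` has
4-divisible counts on parametrised 4-flats of `P` — `l5k_H4` applied to the twisted pair `(f ⊕ ⟨·,y⟩, g(· ⊕ y))`, whose residual is
`(−1)^{⟨·,y⟩} e` (`ad_W_translate`) and whose odd set, period group and off-`P` divisibility are unchanged. [this work] -/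
theorem l5k_H4_twist (f g : (Fin (6 + 6) → Bool) → Bool) (hf : IsDegLeFun 3 f) (hg : IsDegLeFun 3 g)
    (u' : (Fin (6 + 6) → Bool) → ℤ) (hu' : ∀ x, W (fun y => signOf (g y)) x = (2 : ℝ) ^ 5 * (u' x : ℝ))
    (V : Finset (Fin (6 + 6) → Bool)) (xP x' : Fin (6 + 6) → Bool) (h0 : zeroVec ∈ V) (hadd : ∀ a ∈ V, ∀ b ∈ V, bxor a b ∈ V)
    (hS : (univ.filter fun x : Fin (6 + 6) → Bool => Odd (u' x)) = V.image (bxor xP))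
    (hS' : (univ.filter fun x : Fin (6 + 6) → Bool => ¬ Odd (u' x)) = V.image (bxor x'))
    (hP1 : ∀ x, Odd (u' x) → (u' x - 2 * sZ (f x)) ^ 2 = 1) (hoff8 : ∀ x, ¬ Odd (u' x) → (8 : ℤ) ∣ u' x - 2 * sZ (f x))
    (y : Fin (6 + 6) → Bool) (x : Fin (6 + 6) → Bool) (hx : Odd (u' x)) (a : Fin 4 → Fin (6 + 6) → Bool) (ha : ∀ i, a i ∈ V) :
    4 ∣ #(univ.filter fun ε : Fin 4 → Bool =>
      sZ (decide (Odd #(univ.filter fun i => ((fun j => x j ^^ decide (Odd #(univ.filter fun i => ε i && a i j))) i && y i)))) *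
        (u' (fun j => x j ^^ decide (Odd #(univ.filter fun i => ε i && a i j))) -
          2 * sZ (f (fun j => x j ^^ decide (Odd #(univ.filter fun i => ε i && a i j))))) = -1) := by
  classical
  -- the twisted pair
  set ℓ : (Fin (6 + 6) → Bool) → Bool := fun z => decide (Odd #(univ.filter fun i => (z i && y i))) with hℓdef
  set fy : (Fin (6 + 6) → Bool) → Bool := fun z => f z ^^ ℓ z with hfydef
  set gy : (Fin (6 + 6) → Bool) → Bool := fun z => g (bxor z y) with hgydef
  set uy : (Fin (6 + 6) → Bool) → ℤ := fun z => sZ (ℓ z) * u' z with huydef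
  have hfy : IsDegLeFun 3 fy := bb_isDegLeFun_bxor hf ((knf_isDegLeFun_ip y).mono (by norm_num))
  have hgy : IsDegLeFun 3 gy := AffineDigitCaseAFourteen.ad_translate_isDegLeFun g hg y
  have huy : ∀ z, W (fun t => signOf (gy t)) z = (2 : ℝ) ^ 5 * (uy z : ℝ) := by
    intro z
    simp only [gy, uy]
    rw [AffineDigitCaseAFourteen.ad_W_translate g y z, hu' z, twist_comm, vg_twist_eq_signOf]
    push_cast
    rw [tp_sZ_cast]
    simp only [ℓ]
    ring
  have hsℓ : ∀ z, sZ (ℓ z) = 1 ∨ sZ (ℓ z) = -1 := fun z => tp_sZ_cases _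
  have hodd_iff : ∀ z, Odd (uy z) ↔ Odd (u' z) := by
    intro z
    simp only [uy]
    rcases hsℓ z with h | h <;> rw [h] <;> simp
  have hSy : (univ.filter fun z : Fin (6 + 6) → Bool => Odd (uy z)) = V.image (bxor xP) := by
    rw [← hS]; exact filter_congr fun z _ => hodd_iff z
  have hSy' : (univ.filter fun z : Fin (6 + 6) → Bool => ¬ Odd (uy z)) = V.image (bxor x') := by
    rw [← hS']; exact filter_congr fun z _ => by rw [hodd_iff z]
  have hey : ∀ z, uy z - 2 * sZ (fy z) = sZ (ℓ z) * (u' z - 2 * sZ (f z)) := by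
    intro z; simp only [uy, fy]; rw [tee_sZ_xor]; ring
  have hP1y : ∀ z, Odd (uy z) → (uy z - 2 * sZ (fy z)) ^ 2 = 1 := by
    intro z hz
    rw [hey, mul_pow, hP1 z ((hodd_iff z).1 hz)]
    rcases hsℓ z with h | h <;> rw [h] <;> norm_num
  have hoff8y : ∀ z, ¬ Odd (uy z) → (8 : ℤ) ∣ uy z - 2 * sZ (fy z) := by
    intro z hz
    rw [hey]
    exact Dvd.dvd.mul_left (hoff8 z (fun h => hz ((hodd_iff z).2 h))) _
  have h := l5k_H4 fy gy hfy hgy uy huy V xP x' h0 hadd hSy hSy' hP1y hoff8y x ((hodd_iff x).2 hx) a ha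
  have e : (univ.filter fun ε : Fin 4 → Bool =>
      uy (fun j => x j ^^ decide (Odd #(univ.filter fun i => ε i && a i j))) -
        2 * sZ (fy (fun j => x j ^^ decide (Odd #(univ.filter fun i => ε i && a i j)))) = -1) =
      univ.filter fun ε : Fin 4 → Bool =>
        sZ (decide (Odd #(univ.filter fun i => ((fun j => x j ^^ decide (Odd #(univ.filter fun i => ε i && a i j))) i && y i)))) *
          (u' (fun j => x j ^^ decide (Odd #(univ.filter fun i => ε i && a i j))) -
            2 * sZ (f (fun j => x j ^^ decide (Odd #(univ.filter fun i => ε i && a i j))))) = -1 :=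
    filter_congr fun ε _ => by rw [hey]
  rw [e] at h
  exact h

/-! ### 3. `512 ∣ #τ_y` and `ŝ(y) ∈ 1024ℤ` -/

/-- **`512 ∣ #τ_y`.**  Cubic `f, g`, `W_g = 32u'`, some `u'` odd, `Φ ≥ 29/32`, `e² = 1` on the odd set and `8 ∣ e` off it: for every `y`
the set `τ_y = {x odd : (−1)^{x·y} e(x) = −1}` has `512 ∣ #τ_y` (restriction to the 11-flat `P` + the four-flat lemma). [this work] -/
theorem l5k_tau_card (f g : (Fin (6 + 6) → Bool) → Bool) (hf : IsDegLeFun 3 f) (hg : IsDegLeFun 3 g)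
    (u' : (Fin (6 + 6) → Bool) → ℤ) (hu' : ∀ x, W (fun y => signOf (g y)) x = (2 : ℝ) ^ 5 * (u' x : ℝ))
    (hodd : ∃ x, Odd (u' x)) (hΦ : (29 / 32 : ℝ) ≤ forrelation f g)
    (hP1 : ∀ x, Odd (u' x) → (u' x - 2 * sZ (f x)) ^ 2 = 1) (hoff8 : ∀ x, ¬ Odd (u' x) → (8 : ℤ) ∣ u' x - 2 * sZ (f x))
    (y : Fin (6 + 6) → Bool) :
    512 ∣ #(univ.filter fun x : Fin (6 + 6) → Bool => Odd (u' x) ∧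
      sZ (decide (Odd #(univ.filter fun i => (x i && y i)))) * (u' x - 2 * sZ (f x)) = -1) := by
  classical
  obtain ⟨V, xP, x', h0, hadd, hcardV, hS, hS', -, -, -, -, -, -⟩ := l5c_setup f g hg u' hu' hodd hΦ
  have hmemP : ∀ x, x ∈ V.image (bxor xP) ↔ Odd (u' x) := fun x => by rw [← hS]; simp
  have hPV : ∀ x, x ∈ V.image (bxor xP) → ∀ a ∈ V, bxor x a ∈ V.image (bxor xP) :=
    fun x hx a ha => fl1_coset_vadd hadd rfl hx ha
  -- the odd set as `{⟨x,γ⟩ = bP}`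
  obtain ⟨γ, t, ht, hγ, hPt⟩ := tw22_hyperplane_ge2932 f g hg u' hu' hodd hΦ
  set ℓγ : (Fin (6 + 6) → Bool) → Bool := fun x => decide (Odd #(univ.filter fun i => (x i && γ i) = true)) with hℓγ
  have htw : ∀ x, twist γ x = signOf (ℓγ x) := by
    intro x
    rw [vg_twist_eq_signOf]
    have e : (univ.filter fun i => γ i && x i) = univ.filter fun i => (x i && γ i) = true :=
      filter_congr fun i _ => by rw [Bool.and_comm]
    rw [e]
  obtain ⟨bP, hbP⟩ : ∃ bP : Bool, ∀ x, (Odd (u' x) ↔ ℓγ x = bP) := by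
    rcases ht with rfl | rfl
    · refine ⟨false, fun x => ?_⟩
      rw [hPt x, htw x]
      cases ℓγ x <;> norm_num [signOf]
    · refine ⟨true, fun x => ?_⟩
      rw [hPt x, htw x]
      cases ℓγ x <;> norm_num [signOf]
  obtain ⟨i₀, hi₀⟩ := tw59_exists_coord γ hγ
  set c : (Fin (6 + 6) → Bool) → Bool := fun x => decide (Odd (u' x)) &&
    decide (sZ (decide (Odd #(univ.filter fun i => (x i && y i)))) * (u' x - 2 * sZ (f x)) = -1) with hcdef
  obtain ⟨c', -, hcard', htr⟩ := ffl_restrict_flats (k := 11) c γ i₀ hi₀ bP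
  have H4' := htr 4 4 (fun b'' a'' hb'' ha'' => by
    have hbodd : Odd (u' b'') := (hbP b'').2 hb''
    have haV : ∀ i, a'' i ∈ V := by
      intro i
      refine (l5k_memV u' V xP x' h0 hadd hS hS' (a'' i)).2 fun x => ?_
      rw [hbP, hbP]
      have e1 : ℓγ (bxor x (a'' i)) = (ℓγ x ^^ ℓγ (a'' i)) := ffl_ip_bxor x (a'' i) γ
      have ha3 : ℓγ (a'' i) = false := ha'' i
      rw [e1, ha3, Bool.xor_false]
    have hcount := l5k_H4_twist f g hf hg u' hu' V xP x' h0 hadd hS hS' hP1 hoff8 y b'' hbodd a'' haV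
    have e2 : (univ.filter fun ε : Fin 4 → Bool =>
        c (fun j => b'' j ^^ decide (Odd #(univ.filter fun i => ε i && a'' i j))) = true) =
        univ.filter fun ε : Fin 4 → Bool =>
          sZ (decide (Odd #(univ.filter fun i =>
            ((fun j => b'' j ^^ decide (Odd #(univ.filter fun i => ε i && a'' i j))) i && y i)))) *
            (u' (fun j => b'' j ^^ decide (Odd #(univ.filter fun i => ε i && a'' i j))) -
              2 * sZ (f (fun j => b'' j ^^ decide (Odd #(univ.filter fun i => ε i && a'' i j))))) = -1 := by
      refine filter_congr fun ε _ => ?_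
      have hodd_pt : Odd (u' (fun j => b'' j ^^ decide (Odd #(univ.filter fun i => ε i && a'' i j)))) :=
        (hmemP _).1 (ws_flatPt_mem V h0 (fun z => z ∈ V.image (bxor xP)) hPV 4 b'' ((hmemP b'').2 hbodd) a'' haV ε)
      simp only [c, hodd_pt, decide_true, Bool.true_and, decide_eq_true_eq]
    rw [e2]
    exact hcount)
  have hw := ffl_four_weight 11 (by norm_num) c' H4'
  rw [hcard'] at hw
  have e3 : (univ.filter fun x => c x = true ∧ decide (Odd #(univ.filter fun i => (x i && γ i) = true)) = bP) =
      univ.filter fun x : Fin (6 + 6) → Bool => Odd (u' x) ∧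
        sZ (decide (Odd #(univ.filter fun i => (x i && y i)))) * (u' x - 2 * sZ (f x)) = -1 := by
    have hc_iff : ∀ x, c x = true ↔
        (Odd (u' x) ∧ sZ (decide (Odd #(univ.filter fun i => (x i && y i)))) * (u' x - 2 * sZ (f x)) = -1) := by
      intro x; simp only [c, Bool.and_eq_true, decide_eq_true_eq]
    refine filter_congr fun x _ => ?_
    rw [hc_iff x]
    constructor
    · rintro ⟨⟨h1, h2⟩, -⟩; exact ⟨h1, h2⟩
    · rintro ⟨h1, h2⟩; exact ⟨⟨h1, h2⟩, (hbP x).1 h1⟩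
  rw [e3, show (2 : ℕ) ^ (11 - 2) = 512 by norm_num] at hw
  exact hw

/-- **`ŝ(y) ∈ 1024ℤ`.**  In the setting of `l5k_tau_card`: `Σ_{x odd} e(x)(−1)^{x·y} = 1024·k` for an integer `k`. [this work] -/
theorem l5k_shat (f g : (Fin (6 + 6) → Bool) → Bool) (hf : IsDegLeFun 3 f) (hg : IsDegLeFun 3 g)
    (u' : (Fin (6 + 6) → Bool) → ℤ) (hu' : ∀ x, W (fun y => signOf (g y)) x = (2 : ℝ) ^ 5 * (u' x : ℝ))
    (hodd : ∃ x, Odd (u' x)) (hΦ : (29 / 32 : ℝ) ≤ forrelation f g)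
    (hP1 : ∀ x, Odd (u' x) → (u' x - 2 * sZ (f x)) ^ 2 = 1) (hoff8 : ∀ x, ¬ Odd (u' x) → (8 : ℤ) ∣ u' x - 2 * sZ (f x))
    (y : Fin (6 + 6) → Bool) :
    ∃ k : ℤ, ∑ x ∈ univ.filter (fun x : Fin (6 + 6) → Bool => Odd (u' x)),
      ((u' x - 2 * sZ (f x) : ℤ) : ℝ) * twist x y = 1024 * (k : ℝ) := by
  classical
  obtain ⟨k', hk'⟩ := l5k_tau_card f g hf hg u' hu' hodd hΦ hP1 hoff8 y
  have hcardP := tw22_oddset_card_ge2932 f g hg u' hu' hodd hΦ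
  set P := univ.filter (fun x : Fin (6 + 6) → Bool => Odd (u' x)) with hPdef
  set ℓ : (Fin (6 + 6) → Bool) → Bool := fun x => decide (Odd #(univ.filter fun i => (x i && y i))) with hℓdef
  have hpm : ∀ x ∈ P, sZ (ℓ x) * (u' x - 2 * sZ (f x)) = 1 ∨ sZ (ℓ x) * (u' x - 2 * sZ (f x)) = -1 := by
    intro x hx
    have h1 := hP1 x (by simpa [hPdef] using hx)
    have hsq : (sZ (ℓ x) * (u' x - 2 * sZ (f x))) ^ 2 = 1 := by
      rw [mul_pow, h1]; rcases tp_sZ_cases (ℓ x) with h | h <;> rw [h] <;> norm_num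
    have : (sZ (ℓ x) * (u' x - 2 * sZ (f x)) - 1) * (sZ (ℓ x) * (u' x - 2 * sZ (f x)) + 1) = 0 := by nlinarith
    rcases mul_eq_zero.1 this with h | h
    · left; linarith
    · right; linarith
  have hterm : ∀ x ∈ P, ((u' x - 2 * sZ (f x) : ℤ) : ℝ) * twist x y =
      1 - 2 * (if sZ (ℓ x) * (u' x - 2 * sZ (f x)) = -1 then (1 : ℝ) else 0) := by
    intro x hx
    rw [vg_twist_eq_signOf, ← tp_sZ_cast]
    change ((u' x - 2 * sZ (f x) : ℤ) : ℝ) * ((sZ (ℓ x) : ℤ) : ℝ) = _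
    rw [← Int.cast_mul, mul_comm]
    rcases hpm x hx with h | h <;> rw [h] <;> norm_num [h]
  rw [sum_congr rfl hterm, sum_sub_distrib, sum_const, nsmul_eq_mul, mul_one, ← mul_sum, sum_boole, hcardP]
  have e1 : (P.filter fun x => sZ (ℓ x) * (u' x - 2 * sZ (f x)) = -1) =
      univ.filter fun x : Fin (6 + 6) → Bool => Odd (u' x) ∧ sZ (ℓ x) * (u' x - 2 * sZ (f x)) = -1 := by
    ext x; simp [hPdef]
  rw [e1, hk']
  refine ⟨2 - k', ?_⟩
  push_cast
  ring

/-! ### 4. Duality `ê = −64·e_f` and the two kills -/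

/-- **Duality of the residuals**: `Σ_a e(a)(−1)^{a·y} = −64·(u'_f(y) − 2(−1)^{g(y)})` for `W_g = 32u'`, `W_f = 32u'_f`,
`e = u' − 2(−1)^f` (Walsh inversion). [this work] -/
theorem l5k_duality (f g : (Fin (6 + 6) → Bool) → Bool)
    (u' : (Fin (6 + 6) → Bool) → ℤ) (hu' : ∀ x, W (fun y => signOf (g y)) x = (2 : ℝ) ^ 5 * (u' x : ℝ))
    (uf : (Fin (6 + 6) → Bool) → ℤ) (huf : ∀ y, W (fun x => signOf (f x)) y = (2 : ℝ) ^ 5 * (uf y : ℝ))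
    (y : Fin (6 + 6) → Bool) :
    ∑ a, ((u' a - 2 * sZ (f a) : ℤ) : ℝ) * twist a y = -64 * (((uf y - 2 * sZ (g y) : ℤ) : ℝ)) := by
  have h1 : ∑ a, ((u' a : ℤ) : ℝ) * twist a y = 128 * signOf (g y) := by
    have h := tz_inversion (fun t => signOf (g t)) y
    simp_rw [hu'] at h
    have h' : ∑ a, ((u' a : ℤ) : ℝ) * twist a y = (∑ a, (2 : ℝ) ^ 5 * (u' a : ℝ) * twist a y) / 2 ^ 5 := by
      rw [eq_div_iff (by norm_num), sum_mul]
      exact sum_congr rfl fun a _ => by ring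
    rw [h', h]
    norm_num
    ring
  have h2 : ∑ a, ((sZ (f a) : ℤ) : ℝ) * twist a y = (2 : ℝ) ^ 5 * (uf y : ℝ) := by
    rw [← huf y]; unfold W; exact sum_congr rfl fun a _ => by rw [tp_sZ_cast]
  have e : ∀ a, ((u' a - 2 * sZ (f a) : ℤ) : ℝ) * twist a y =
      ((u' a : ℤ) : ℝ) * twist a y - 2 * (((sZ (f a) : ℤ) : ℝ) * twist a y) := by
    intro a; push_cast; ring
  rw [sum_congr rfl fun a _ => e a, sum_sub_distrib, ← mul_sum, h1, h2]
  push_cast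
  rw [tp_sZ_cast]
  ring


end Summit.QuantumAdvantage.QuantumAdvantage.Theorems.CubicForrelation.NearExactIsExact

end
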